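import Summits.KontsevichZagierPeriods.KontsevichZagierPeriods.Theses.FurushoPentagon
import Summits.KontsevichZagierPeriods.KontsevichZagierPeriods.Theorems.ReducedPeriodRing.Negative.PositiveCone
import Summits.KontsevichZagierPeriods.KontsevichZagierPeriods.Theorems.ReducedPeriodRing.Negative.ModelsAnatomy
import Summits.KontsevichZagierPeriods.KontsevichZagierPeriods.Theorems.ReducedPeriodRing.Negative.WitnessPairs
import Summits.KontsevichZagierPeriods.KontsevichZagierPeriods.Theorems.ReducedPeriodRing.Negative.DimZero
import Literature.NumberTheory.Transcendental.KZKernelConjectureForms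
import Literature.NumberTheory.Transcendental.KZVolumeConjectureProofs

/-!
# `ReducedPeriodRing` (stmt-KontsevichZagierPeriods-3929) — the order of `P` is determined by `eval`

Negative knowledge for the crux (the ORDER lens is closed). Let `C ⊆ FormalRep` be the positive cone
(sums of representations with non-negative integrands, `Negative/PositiveCone.lean`) and `C̄` its
closure modulo `KZ.relations`. The ordered interface `(P, C̄, eval)` of the formal period ring
`P = FormalRep ⧸ relations` carries NO information beyond `(P, eval)`:

* `exists_body_of_eval_pos` — every formal combination of POSITIVE value is, modulo the moves, the
  volume `[K, 1]` of ONE compact `ℚ`-semialgebraic body with non-empty interior (single-representation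
  normal form `exists_sub_of_mem_relations` + the tree's PROVED Viu-Sos semi-canonical reduction
  `KZ.semiCanonicalReduction_holds`, via `exists_compactVolume_of_value_pos`);
* `exists_cone_sub_mem_relations_iff` — hence `c ∈ C̄ ↔ 0 < eval c ∨ c ∈ relations`: the cone
  closure is DEFINABLE from `eval` (order trichotomy `pos_or_neg_or_eval_eq_zero`);
* `infinitesimal_iff_eval_eq_zero` — `c` is infinitesimal (`−d ≼ c ≼ d` for every `d` of positive
  value) iff `eval c = 0`; so Conjecture 1 (kernel form `KZKernelConjecture`) is EXACTLY the
  Archimedean property of `(P, C̄)` (`kzKernelConjecture_iff_archimedean`), every square-zero class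
  is infinitesimal (`infinitesimal_of_sq_mem_relations`), and the crux is "no infinitesimal squares
  to zero" (`reducedPeriodRing_iff_infinitesimal`);
* `ordered_interface_admits_nilpotents` — over the abstract interface (commutative ring, evaluation
  character, a cone EQUAL to `{ev > 0} ∪ {0}`, i.e. satisfying this very trichotomy) nilpotents
  exist (dual numbers), so no ordered-ring argument (Archimedean f-rings, lattice orders, …) proves
  the crux: `P` is not known Archimedean — that is the summit — and its order says nothing else.

Recorded for the crux census (STRATEGY-CENSUS §3, S⁺₄: "Conjecture 1 is the passage to the limit
ε → 0"); lead c8, `--supports stmt-KontsevichZagierPeriods-3929`.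
[Kontsevich–Zagier 2001, §1.2; Viu-Sos, IJNT 17 (2021), Thm. 1.1; Cresson–Viu-Sos, JTNB 34 (2022), §1]
-/

noncomputable section

namespace Summit.KontsevichZagierPeriods.KontsevichZagierPeriods.ReducedPeriodRingNegative

open MeasureTheory Set
open Literature.NumberTheory.Transcendental KZ
open Literature.ModelTheory.ExponentialFields (IsSemialgebraic isSemialgebraic_univ)
open Summit.KontsevichZagierPeriods.KontsevichZagierPeriods.Theses.FurushoPentagon

/-! ### Positive classes are volumes of bodies -/

/-- **Unit-volume normal form.** A formal combination of POSITIVE value is, modulo the moves, the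
volume representation `[K, 1]` of one compact `ℚ`-semialgebraic body `K` with non-empty interior
(merge `c` into one signed representation, `exists_sub_of_mem_relations`; its value is `eval c > 0`;
apply Viu-Sos' semi-canonical reduction, `exists_compactVolume_of_value_pos`).
[Viu-Sos, IJNT 17 (2021), Thm. 1.1] -/
theorem exists_body_of_eval_pos {c : FormalRep} (h : 0 < eval c) :
    ∃ (m : ℕ) (K : IntegralRep m), IsCompact K.domain ∧ (interior K.domain).Nonempty ∧
      (∀ z ∈ K.domain, K.integrand z = 1) ∧ c - of K ∈ relations := by
  obtain ⟨N, R, hR⟩ := exists_sub_of_mem_relations c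
  have hv : R.value = eval c := by
    have h1 : eval (c - of R) = 0 := relations_le_ker_eval_holds hR
    rw [map_sub, eval_of, sub_eq_zero] at h1
    exact h1.symm
  obtain ⟨m, K, hKc, hKi, hK1, hRK⟩ := exists_compactVolume_of_value_pos R (by rw [hv]; exact h)
  refine ⟨m, K, hKc, hKi, hK1, ?_⟩
  have := relations.add_mem hR hRK
  simpa using this

/-- The mirror statement: a formal combination of NEGATIVE value is `−[K, 1]` for a compact body `K`
with non-empty interior. [Viu-Sos, IJNT 17 (2021), Thm. 1.1] -/
theorem exists_body_of_eval_neg {c : FormalRep} (h : eval c < 0) :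
    ∃ (m : ℕ) (K : IntegralRep m), IsCompact K.domain ∧ (interior K.domain).Nonempty ∧
      (∀ z ∈ K.domain, K.integrand z = 1) ∧ c + of K ∈ relations := by
  obtain ⟨m, K, hKc, hKi, hK1, hK⟩ := exists_body_of_eval_pos (c := -c) (by rw [map_neg]; linarith)
  refine ⟨m, K, hKc, hKi, hK1, ?_⟩
  have := relations.neg_mem hK
  simpa [sub_eq_add_neg, add_comm] using this

/-- **Order trichotomy of the formal period ring.** Every formal combination is, modulo the moves,
the volume of a compact body, or minus such a volume, or has value `0`. (The third case is NOT
"`c ∈ relations`": that upgrade is Conjecture 1.) [Viu-Sos, IJNT 17 (2021), Thm. 1.1] -/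
theorem pos_or_neg_or_eval_eq_zero (c : FormalRep) :
    (∃ (m : ℕ) (K : IntegralRep m), IsCompact K.domain ∧ (interior K.domain).Nonempty ∧
        (∀ z ∈ K.domain, K.integrand z = 1) ∧ c - of K ∈ relations) ∨
      (∃ (m : ℕ) (K : IntegralRep m), IsCompact K.domain ∧ (interior K.domain).Nonempty ∧
        (∀ z ∈ K.domain, K.integrand z = 1) ∧ c + of K ∈ relations) ∨
      eval c = 0 := by
  rcases lt_trichotomy 0 (eval c) with h | h | h
  · exact Or.inl (exists_body_of_eval_pos h)
  · exact Or.inr (Or.inr h.symm)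
  · exact Or.inr (Or.inl (exists_body_of_eval_neg h))

/-! ### The cone closure is definable from `eval` -/

/-- **The closure of the positive cone modulo relations is `{eval > 0} ∪ relations`.** (`→`: a cone
element has non-negative value, and value `0` puts it in `relations`,
`mem_relations_of_mem_cone_of_eval_eq_zero`; `←`: `exists_body_of_eval_pos`.) Consequently the
partial order of `P = FormalRep ⧸ relations` defined by the cone is the pull-back of the order of `ℝ`
along `eval`, glued with equality. [folklore] -/
theorem exists_cone_sub_mem_relations_iff (c : FormalRep) :
    (∃ p ∈ AddSubmonoid.closure (FreeAbelianGroup.of ''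
        {x : Σ n, IntegralRep n | ∀ y ∈ x.2.domain, 0 ≤ x.2.integrand y}), c - p ∈ relations) ↔
      0 < eval c ∨ c ∈ relations := by
  constructor
  · rintro ⟨p, hp, hcp⟩
    have hcv : eval c = eval p := by
      have h1 : eval (c - p) = 0 := relations_le_ker_eval_holds hcp
      rwa [map_sub, sub_eq_zero] at h1
    rcases (eval_nonneg_of_mem_cone hp).lt_or_eq with hlt | heq
    · exact Or.inl (hcv ▸ hlt)
    · refine Or.inr ?_
      have hp0 : p ∈ relations := mem_relations_of_mem_cone_of_eval_eq_zero hp heq.symm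
      have := relations.add_mem hcp hp0
      simpa using this
  · rintro (h | h)
    · obtain ⟨m, K, -, -, hK1, hK⟩ := exists_body_of_eval_pos h
      exact ⟨of K, of_mem_cone K (fun z hz => by rw [hK1 z hz]; exact zero_le_one), hK⟩
    · exact ⟨0, AddSubmonoid.zero_mem _, by simpa using h⟩

/-- The closure of `−cone` is `{eval < 0} ∪ relations`. [folklore] -/
theorem exists_cone_add_mem_relations_iff (c : FormalRep) :
    (∃ p ∈ AddSubmonoid.closure (FreeAbelianGroup.of ''
        {x : Σ n, IntegralRep n | ∀ y ∈ x.2.domain, 0 ≤ x.2.integrand y}), c + p ∈ relations) ↔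
      eval c < 0 ∨ c ∈ relations := by
  have h := exists_cone_sub_mem_relations_iff (-c)
  simp only [map_neg, neg_pos, neg_mem_iff] at h
  rw [← h]
  constructor
  · rintro ⟨p, hp, hcp⟩
    refine ⟨p, hp, ?_⟩
    have := relations.neg_mem hcp
    have heq : -(c + p) = -c - p := by abel
    rwa [heq] at this
  · rintro ⟨p, hp, hcp⟩
    refine ⟨p, hp, ?_⟩
    have := relations.neg_mem hcp
    have heq : -(-c - p) = c + p := by abel
    rwa [heq] at this

/-- `C̄ ∩ (−C̄) = relations`: a class which is both `≽ 0` and `≼ 0` is `0` in `P`. [folklore] -/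
theorem mem_relations_of_cone_sub_of_cone_add {c p q : FormalRep}
    (hp : p ∈ AddSubmonoid.closure (FreeAbelianGroup.of ''
        {x : Σ n, IntegralRep n | ∀ y ∈ x.2.domain, 0 ≤ x.2.integrand y}))
    (hq : q ∈ AddSubmonoid.closure (FreeAbelianGroup.of ''
        {x : Σ n, IntegralRep n | ∀ y ∈ x.2.domain, 0 ≤ x.2.integrand y}))
    (hcp : c - p ∈ relations) (hcq : c + q ∈ relations) : c ∈ relations := by
  rcases (exists_cone_sub_mem_relations_iff c).mp ⟨p, hp, hcp⟩ with h1 | h1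
  · rcases (exists_cone_add_mem_relations_iff c).mp ⟨q, hq, hcq⟩ with h2 | h2
    · exact absurd h1 (not_lt.mpr h2.le)
    · exact h2
  · exact h1

/-! ### Infinitesimals are the kernel of `eval`; Conjecture 1 is the Archimedean property -/

/-- Constants of every positive rational value exist (the `0`-dimensional representation `[pt, q]`).
[Kontsevich–Zagier 2001, §1.1] -/
theorem exists_eval_of_eq_ratCast (q : ℚ) : ∃ r : IntegralRep 0, eval (of r) = q := by
  have hfin : volume (univ : Set (Fin 0 → ℝ)) ≠ ⊤ := by
    rw [volume_univ_fin_zero]; exact ENNReal.one_ne_top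
  let r : IntegralRep 0 :=
    ⟨univ, fun _ => (q : ℝ), isSemialgebraic_univ, isSemialgebraicFunOn_ratCast isSemialgebraic_univ q,
      integrableOn_const hfin⟩
  refine ⟨r, ?_⟩
  rw [eval_of, value_eq_integrand_default r rfl]

/-- **Infinitesimals = `ker eval`.** A class `c` is dominated by every class of positive value
(`−d ≼ c ≼ d` in the cone order, for all `d` with `eval d > 0`) iff `eval c = 0`. (`→`: test
against the constants `[pt, q]`, `q ∈ ℚ_{>0}`; `←`: `eval (d ∓ c) = eval d > 0` and
`exists_cone_sub_mem_relations_iff`.) [folklore] -/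
theorem infinitesimal_iff_eval_eq_zero (c : FormalRep) :
    (∀ d : FormalRep, 0 < eval d →
        (∃ p ∈ AddSubmonoid.closure (FreeAbelianGroup.of ''
          {x : Σ n, IntegralRep n | ∀ y ∈ x.2.domain, 0 ≤ x.2.integrand y}), d - c - p ∈ relations) ∧
        (∃ p ∈ AddSubmonoid.closure (FreeAbelianGroup.of ''
          {x : Σ n, IntegralRep n | ∀ y ∈ x.2.domain, 0 ≤ x.2.integrand y}), d + c - p ∈ relations)) ↔
      eval c = 0 := by
  constructor
  · intro h
    -- `|eval c| ≤ q` for every positive rational `q`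
    have key : ∀ q : ℚ, 0 < q → |eval c| ≤ q := by
      intro q hq
      obtain ⟨r, hr⟩ := exists_eval_of_eq_ratCast q
      have hd : 0 < eval (of r) := by rw [hr]; exact_mod_cast hq
      obtain ⟨h1, h2⟩ := h (of r) hd
      have e1 := (exists_cone_sub_mem_relations_iff _).mp h1
      have e2 := (exists_cone_sub_mem_relations_iff _).mp h2
      have v1 : 0 ≤ eval (of r - c) := by
        rcases e1 with e | e
        · exact e.le
        · exact (relations_le_ker_eval_holds e : eval (of r - c) = 0).ge
      have v2 : 0 ≤ eval (of r + c) := by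
        rcases e2 with e | e
        · exact e.le
        · exact (relations_le_ker_eval_holds e : eval (of r + c) = 0).ge
      rw [map_sub, hr] at v1
      rw [map_add, hr] at v2
      rw [abs_le]
      constructor <;> linarith
    by_contra hne
    have hpos : 0 < |eval c| := abs_pos.mpr hne
    obtain ⟨q, hq0, hq⟩ := exists_rat_btwn hpos
    have := key q (by exact_mod_cast hq0)
    linarith
  · intro h d hd
    constructor
    · exact (exists_cone_sub_mem_relations_iff _).mpr (Or.inl (by rw [map_sub, h, sub_zero]; exact hd))
    · exact (exists_cone_sub_mem_relations_iff _).mpr (Or.inl (by rw [map_add, h, add_zero]; exact hd))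

/-- **Conjecture 1 ⇔ `(P, C̄)` is Archimedean.** The kernel form of the Kontsevich–Zagier conjecture
(`KZKernelConjecture`: `eval c = 0 → c ∈ relations`) says exactly that the only infinitesimal of
the ordered group `(P, C̄)` is `0`: Conjecture 1 is the passage to the limit `ε → 0` in "two bodies
of equal volume are move-equivalent up to bodies of arbitrarily small rational volume".
[Kontsevich–Zagier 2001, §1.2; Cresson–Viu-Sos, JTNB 34 (2022), §1] -/
theorem kzKernelConjecture_iff_archimedean :
    KZKernelConjecture ↔
      ∀ c : FormalRep, (∀ d : FormalRep, 0 < eval d →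
        (∃ p ∈ AddSubmonoid.closure (FreeAbelianGroup.of ''
          {x : Σ n, IntegralRep n | ∀ y ∈ x.2.domain, 0 ≤ x.2.integrand y}), d - c - p ∈ relations) ∧
        (∃ p ∈ AddSubmonoid.closure (FreeAbelianGroup.of ''
          {x : Σ n, IntegralRep n | ∀ y ∈ x.2.domain, 0 ≤ x.2.integrand y}), d + c - p ∈ relations)) →
        c ∈ relations := by
  constructor
  · intro hK c hc
    exact hK c ((infinitesimal_iff_eval_eq_zero c).mp hc)
  · intro h c hc
    exact h c ((infinitesimal_iff_eval_eq_zero c).mpr hc)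

/-- **Every square-zero class is infinitesimal** (its value squares to `0`). [folklore] -/
theorem infinitesimal_of_sq_mem_relations {c : FormalRep} (hc : c * c ∈ relations) :
    ∀ d : FormalRep, 0 < eval d →
      (∃ p ∈ AddSubmonoid.closure (FreeAbelianGroup.of ''
        {x : Σ n, IntegralRep n | ∀ y ∈ x.2.domain, 0 ≤ x.2.integrand y}), d - c - p ∈ relations) ∧
      (∃ p ∈ AddSubmonoid.closure (FreeAbelianGroup.of ''
        {x : Σ n, IntegralRep n | ∀ y ∈ x.2.domain, 0 ≤ x.2.integrand y}), d + c - p ∈ relations) := by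
  refine (infinitesimal_iff_eval_eq_zero c).mpr ?_
  have h0 : eval (c * c) = 0 := relations_le_ker_eval_holds hc
  rw [eval_mul'] at h0
  exact mul_self_eq_zero.mp h0

/-- **The crux in the order language**: `ReducedPeriodRing` iff no INFINITESIMAL class squares to
zero without being zero. The restriction to infinitesimals is free (`infinitesimal_of_sq_mem_relations`),
which is the precise sense in which the order of `P` cannot help: the crux lives entirely inside
`ker eval`, where `C̄` sees nothing. [folklore] -/
theorem reducedPeriodRing_iff_infinitesimal :
    ReducedPeriodRing ↔
      ∀ c : FormalRep, (∀ d : FormalRep, 0 < eval d →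
        (∃ p ∈ AddSubmonoid.closure (FreeAbelianGroup.of ''
          {x : Σ n, IntegralRep n | ∀ y ∈ x.2.domain, 0 ≤ x.2.integrand y}), d - c - p ∈ relations) ∧
        (∃ p ∈ AddSubmonoid.closure (FreeAbelianGroup.of ''
          {x : Σ n, IntegralRep n | ∀ y ∈ x.2.domain, 0 ≤ x.2.integrand y}), d + c - p ∈ relations)) →
        c * c ∈ relations → c ∈ relations := by
  constructor
  · intro h c _ hc
    exact h c hc
  · intro h c hc
    exact h c (infinitesimal_of_sq_mem_relations hc) hc

/-! ### The abstract ordered interface admits nilpotents -/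

/-- **No ordered-ring argument proves the crux.** Everything the calculus knows about the order of
`P` is the trichotomy `C̄ = {ev > 0} ∪ {0}` over a commutative ring with an evaluation character;
that interface has a model with a non-zero square-zero element: the dual numbers `ℚ[ε]`,
`ev (a + bε) = a`, cone `{a + bε | a > 0} ∪ {0}` (closed under `+` and `·`, `ev > 0` off `0`,
`C ∩ −C = 0`, every element `≽ 0`, `≼ 0` or infinitesimal), with `ε² = 0 ≠ ε`. [folklore] -/
theorem ordered_interface_admits_nilpotents :
    ∃ (R : Type) (_ : CommRing R) (ev : R →+* ℚ) (C : Set R), Function.Surjective ev ∧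
      (∀ x : R, x ∈ C ↔ 0 < ev x ∨ x = 0) ∧ (∀ x ∈ C, ∀ y ∈ C, x + y ∈ C) ∧
      (∀ x ∈ C, ∀ y ∈ C, x * y ∈ C) ∧ (∀ x ∈ C, -x ∈ C → x = 0) ∧
      (∀ x : R, x ∈ C ∨ -x ∈ C ∨ ev x = 0) ∧ ∃ e : R, e ≠ 0 ∧ e * e = 0 := by
  refine ⟨DualNumber ℚ, inferInstance, (TrivSqZeroExt.fstHom ℚ ℚ ℚ).toRingHom,
    {x | 0 < TrivSqZeroExt.fst x ∨ x = 0}, ?_, ?_, ?_, ?_, ?_, ?_, ?_⟩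
  · intro q
    exact ⟨TrivSqZeroExt.inl q, by simp⟩
  · intro x
    simp
  · rintro x (hx | rfl) y (hy | rfl)
    · left; simp only [TrivSqZeroExt.fst_add]; linarith
    · left; simpa using hx
    · left; simpa using hy
    · right; simp
  · rintro x (hx | rfl) y (hy | rfl)
    · left; simp only [TrivSqZeroExt.fst_mul]; positivity
    · right; simp
    · right; simp
    · right; simp
  · rintro x (hx | rfl) hneg
    · rcases hneg with h | h
      · simp only [TrivSqZeroExt.fst_neg] at h; linarith
      · exact neg_eq_zero.mp h
    · rfl
  · intro x
    rcases lt_trichotomy 0 (TrivSqZeroExt.fst x) with h | h | h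
    · exact Or.inl (Or.inl h)
    · right; right; simpa using h.symm
    · right; left; left; simp only [TrivSqZeroExt.fst_neg]; linarith
  · refine ⟨DualNumber.eps, ?_, DualNumber.eps_mul_eps⟩
    intro h
    have := congrArg TrivSqZeroExt.snd h
    simp at this

/-! ### Conjecture 1 holds up to an error body of arbitrarily small volume -/

/-- **Equal values ⇒ move-equivalent up to bodies of volume `ε`.** If `eval c = 0` (e.g.
`c = [A] − [B]` for two representations of the same value) then for every rational `ε > 0` there are
two compact `ℚ`-semialgebraic bodies `E`, `E'` with non-empty interiors, BOTH OF VOLUME `ε`, such that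
the rules prove `c + vol E = vol E'` (`c + [E, 1] − [E', 1] ∈ relations`). Conjecture 1 is exactly
the statement that the error bodies can be dispensed with (`kzKernelConjecture_iff_archimedean`);
no uniformity in `ε` is claimed or expected. (Proof: `[pt, ε] ∼ [E, 1]` and `c + [pt, ε] ∼ [E', 1]`
by `exists_body_of_eval_pos`.) [Viu-Sos, IJNT 17 (2021), Thm. 1.1] -/
theorem exists_body_add_sub_body_mem_relations {c : FormalRep} (hc : eval c = 0) {ε : ℚ}
    (hε : 0 < ε) :
    ∃ (m : ℕ) (E : IntegralRep m) (m' : ℕ) (E' : IntegralRep m'),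
      IsCompact E.domain ∧ (interior E.domain).Nonempty ∧ (∀ z ∈ E.domain, E.integrand z = 1) ∧
      IsCompact E'.domain ∧ (interior E'.domain).Nonempty ∧ (∀ z ∈ E'.domain, E'.integrand z = 1) ∧
      E.value = ε ∧ E'.value = ε ∧ c + of E - of E' ∈ relations := by
  obtain ⟨r, hr⟩ := exists_eval_of_eq_ratCast ε
  have hd : 0 < eval (of r) := by rw [hr]; exact_mod_cast hε
  obtain ⟨m, E, hEc, hEi, hE1, hE⟩ := exists_body_of_eval_pos hd
  obtain ⟨m', E', hE'c, hE'i, hE'1, hE'⟩ :=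
    exists_body_of_eval_pos (c := c + of r) (by rw [map_add, hc, zero_add]; exact hd)
  refine ⟨m, E, m', E', hEc, hEi, hE1, hE'c, hE'i, hE'1, ?_, ?_, ?_⟩
  · have h1 : eval (of r - of E) = 0 := relations_le_ker_eval_holds hE
    rw [map_sub, sub_eq_zero, hr, eval_of] at h1
    exact h1.symm
  · have h1 : eval (c + of r - of E') = 0 := relations_le_ker_eval_holds hE'
    rw [map_sub, sub_eq_zero, map_add, hc, zero_add, hr, eval_of] at h1
    exact h1.symm
  · -- `c + [E] − [E'] = (c + [r] − [E']) − ([r] − [E])`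
    have heq : c + of E - of E' = (c + of r - of E') - (of r - of E) := by abel
    rw [heq]
    exact relations.sub_mem hE' hE

/-- The two-body form: representations `a`, `b` OF EQUAL VALUE become move-equivalent after adding
to each a compact body of the same, arbitrarily small, rational volume `ε`:
`[a] + [E, 1] ∼ [b] + [E', 1]`, `vol E = vol E' = ε`. [Viu-Sos, IJNT 17 (2021), Thm. 1.1] -/
theorem exists_body_add_equivalent_add_body {n n' : ℕ} (a : IntegralRep n) (b : IntegralRep n')
    (hab : a.value = b.value) {ε : ℚ} (hε : 0 < ε) :
    ∃ (m : ℕ) (E : IntegralRep m) (m' : ℕ) (E' : IntegralRep m'),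
      IsCompact E.domain ∧ (interior E.domain).Nonempty ∧ (∀ z ∈ E.domain, E.integrand z = 1) ∧
      IsCompact E'.domain ∧ (interior E'.domain).Nonempty ∧ (∀ z ∈ E'.domain, E'.integrand z = 1) ∧
      E.value = ε ∧ E'.value = ε ∧ (of a + of E) - (of b + of E') ∈ relations := by
  obtain ⟨m, E, m', E', h1, h2, h3, h4, h5, h6, h7, h8, h⟩ :=
    exists_body_add_sub_body_mem_relations (c := of a - of b)
      (by rw [map_sub, eval_of, eval_of, hab, sub_self]) hε
  refine ⟨m, E, m', E', h1, h2, h3, h4, h5, h6, h7, h8, ?_⟩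
  have heq : of a + of E - (of b + of E') = of a - of b + of E - of E' := by abel
  rw [heq]
  exact h

end Summit.KontsevichZagierPeriods.KontsevichZagierPeriods.ReducedPeriodRingNegative
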